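import Literature.NumberTheory.NumberFields.QuadraticSqrtTwoClassNumberDvdFourCertificate
import Literature.NumberTheory.IwasawaTheory.ClassNumberPExpLayerOneEqOneOfGenusCertificate
import HarnessLib

/-!
# `e₁ ≥ 2` FROM THE BASE FIELD: `2 ≤ ord₂ h(K_1)` for the first layer `K_1 = K(√2)` of the cyclotomic `ℤ₂`-extension of an odd-degree
# field `K` (`2 ∤ d_K`, one real place, at most two infinite places) from an ORDER-FOUR CERTIFICATE written in `𝓞_K`

`Proofs`-style file (theorems only: no definition, no named fact, no instance, no `sorry`) in topic `NumberTheory/IwasawaTheory` (namespace = path),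
written by the prover seat `bsd-line-att-p4` g40 (cell `bsd-f1-sign2`, route `AlignedTransportAtTwo`; `--supports` stmt-BirchSwinnertonDyer-22298, closes
nothing).  It is the `ℤ₂`-tower packaging of this seat's `NumberFields/QuadraticSqrtTwoClassNumberDvdFourCertificate` (`4 ∣ h(K(√2))` from three units
modulo `±` squares, an ideal of order `4`, and residue certificates), the mirror image of att-p3 g43's `ClassNumberPExpLayerOneEqOneOfGenusCertificate`
(`e₁ = 1`): every datum about the (abstract) layer `K_1 ∋ √2` is replaced by IDENTITIES IN `𝓞_K` between the coordinates on `1, √2` — so that a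
Summits row can decide them in `ℤ[θ]` by `linear_combination` and the residue certificates by `decide`.

* ★★ `two_le_classNumberPExp_one_of_orderFourCert` — `K` with `2 ∤ [K:ℚ]`, `2 ∤ d_K`, `0 < r₁(K)`, `#Pl_∞(K) ≤ 2`, `κ` cyclotomic; coordinates
  `(a_i, b_i)` of three units of `K_1` with inverses `(c_i, d_i)`; `w = A + B√2`, `w* = W₀ + W₁√2` with `q₀⁴ = w·w*`, Bézout `μw + νw* = 1`;
  `v = v₀ + v₁√2` and witnesses for `(q₀, v)² = (w, q₀²)`; `q₀ ≠ 0`; and the `31` residue certificates ⟹ **`2 ≤ classNumberPExp κ 1`**.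

CELL READING (crux C2, u7 sub-cell, `t = 3`, regime (β), e.g. `N = 12163`): this is the displayed input «`e₁ ≥ 2`» of att-p3 g46's pro-cyclic door
(`t = 3 ∧ e₁ ≥ 2 ⟹ μ₂ = 0, λ₂ ≤ 1`).  Nothing about any seed is asserted here; BSD is not advanced by this file.

References: [NeukirchANT1999] Ch. I §3, §7 Thm. (7.4), §8; [Cohen1993] §4.7, §6.5; [Washington1997] §13.1 (the layers of the cyclotomic
`ℤ₂`-extension; `K_1 = K(√2)` for `[K:ℚ]` odd); [Marcus2018] Ch. 3 Thm. 27.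
-/

set_option autoImplicit false

noncomputable section

open scoped NumberField nonZeroDivisors
open NumberField IsDedekindDomain

namespace Literature.NumberTheory.IwasawaTheory

open Literature.NumberTheory.EllipticCurves Literature.NumberTheory.NumberFields

variable {K : Type} [Field K] [NumberField K]

/-- ★★ **`2 ≤ ord₂ h(K_1)` from an order-four certificate in `𝓞_K`.**  `K` a number field with `2 ∤ [K:ℚ]`, `2 ∤ d_K`, a real place and at most two
infinite places; `κ` a cyclotomic `ℤ₂`-extension (so `K_1 = κ.layer 1 ∋ s`, `s² = 2`, `s ∉ K`).  DATA in `𝓞_K` (coordinates on `1, s`): units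
`u_i = a_i + b_i s` with inverses `c_i + d_i s` (`a_i c_i + 2 b_i d_i = 1`, `a_i d_i + b_i c_i = 0`), `w = A + Bs`, `w* = W₀ + W₁ s` with `q₀⁴ = w w*`,
`μ w + ν w* = 1`, `v = v₀ + v₁ s` with `q₀ v = α w + β q₀²`, `v² = γ w + δ q₀²`, `w = m q₀² + n (q₀ v) + l v²` (all as pairs of coordinate identities),
`q₀ ≠ 0`; and for every `(e₁,e₂,e₃,e₄,±) ≠ (0,0,0,0,+)` with `e_i ≤ 1` a residue certificate `ψ : 𝓞_K → ℤ/q`, `2t = 1`, `ψ(ρ)² = 2`,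
`±∏(ψa_i + ψb_i ψρ)^{e_i}(ψA + ψB ψρ)^{e₄}` not a square.  THEN `2 ≤ classNumberPExp κ 1` (`(q₀, v)` has order `4` in `Cl(K_1)`:
`NumberFields.two_le_padicValNat_card_classGroup_of_orderFourCert`). [cite: NeukirchANT1999, Ch. I §7 Thm. (7.4), Ch. I §3, Ch. I §8]
[cite: Washington1997, §13.1 (`K_1 = K(√2)`)] [cite: Cohen1993, §6.5 (verification of class group and unit computations)] -/
theorem two_le_classNumberPExp_one_of_orderFourCert (hK : ¬ 2 ∣ Module.finrank ℚ K) (hd : ¬ (2 : ℤ) ∣ NumberField.discr K)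
    (hreal : 0 < NumberField.InfinitePlace.nrRealPlaces K) (hPl : Fintype.card (NumberField.InfinitePlace K) ≤ 2)
    (κ : ZpExtension K 2) (hκ : κ.IsCyclotomic) [NumberField (κ.layer 1)]
    {a₁ b₁ c₁ d₁ a₂ b₂ c₂ d₂ a₃ b₃ c₃ d₃ A B W₀ W₁ μ₀ μ₁ ν₀ ν₁ q₀ v₀ v₁ α₀ α₁ β₀ β₁ γ₀ γ₁ δ₀ δ₁ m₀ m₁ n₀ n₁ l₀ l₁ : 𝓞 K}
    (hu₁ : a₁ * c₁ + 2 * b₁ * d₁ = 1 ∧ a₁ * d₁ + b₁ * c₁ = 0)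
    (hu₂ : a₂ * c₂ + 2 * b₂ * d₂ = 1 ∧ a₂ * d₂ + b₂ * c₂ = 0)
    (hu₃ : a₃ * c₃ + 2 * b₃ * d₃ = 1 ∧ a₃ * d₃ + b₃ * c₃ = 0)
    (hws : q₀ ^ 4 = A * W₀ + 2 * B * W₁ ∧ (0 : 𝓞 K) = A * W₁ + B * W₀)
    (hbez : μ₀ * A + 2 * μ₁ * B + ν₀ * W₀ + 2 * ν₁ * W₁ = 1 ∧ μ₀ * B + μ₁ * A + ν₀ * W₁ + ν₁ * W₀ = 0)
    (hq₀ : q₀ ≠ 0)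
    (hM2 : q₀ * v₀ = α₀ * A + 2 * α₁ * B + β₀ * q₀ ^ 2 ∧ q₀ * v₁ = α₀ * B + α₁ * A + β₁ * q₀ ^ 2)
    (hM3 : v₀ ^ 2 + 2 * v₁ ^ 2 = γ₀ * A + 2 * γ₁ * B + δ₀ * q₀ ^ 2 ∧ 2 * v₀ * v₁ = γ₀ * B + γ₁ * A + δ₁ * q₀ ^ 2)
    (hM4 : A = m₀ * q₀ ^ 2 + (n₀ * (q₀ * v₀) + 2 * n₁ * (q₀ * v₁)) + (l₀ * (v₀ ^ 2 + 2 * v₁ ^ 2) + 2 * l₁ * (2 * v₀ * v₁)) ∧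
      B = m₁ * q₀ ^ 2 + (n₀ * (q₀ * v₁) + n₁ * (q₀ * v₀)) + (l₀ * (2 * v₀ * v₁) + l₁ * (v₀ ^ 2 + 2 * v₁ ^ 2)))
    (hcert : ∀ (e₁ e₂ e₃ e₄ : ℕ) (σ : ℤˣ), e₁ ≤ 1 → e₂ ≤ 1 → e₃ ≤ 1 → e₄ ≤ 1 →
      ¬ (e₁ = 0 ∧ e₂ = 0 ∧ e₃ = 0 ∧ e₄ = 0 ∧ σ = 1) →
      ∃ (q : ℕ) (ψ : 𝓞 K →+* ZMod q) (t : ZMod q) (ρ : 𝓞 K), 2 * t = 1 ∧ ψ ρ ^ 2 = 2 ∧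
        ¬ IsSquare (((σ : ℤ) : ZMod q) * (ψ a₁ + ψ b₁ * ψ ρ) ^ e₁ * (ψ a₂ + ψ b₂ * ψ ρ) ^ e₂ *
          (ψ a₃ + ψ b₃ * ψ ρ) ^ e₃ * (ψ A + ψ B * ψ ρ) ^ e₄)) :
    2 ≤ classNumberPExp κ 1 := by
  classical
  haveI : Fact (Nat.Prime 2) := ⟨Nat.prime_two⟩
  haveI : FiniteDimensional K (κ.layer 1) := κ.finiteDimensional_layer_holds 1
  haveI : IsGalois K (κ.layer 1) := κ.isGalois_layer_holds 1
  have hdeg : Module.finrank K (κ.layer 1) = 2 := by rw [κ.finrank_layer_holds 1, pow_one]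
  -- `√2 ∈ 𝓞_{K_1} ∖ K`
  obtain ⟨s, hs⟩ := exists_sq_eq_two_layer_one_of_not_dvd_finrank hK κ hκ
  have hsK : ∀ x : K, algebraMap K (κ.layer 1) x ≠ s := forall_algebraMap_ne_of_sq_eq_two hd hs
  have hsint : IsIntegral ℤ s := by
    refine ⟨Polynomial.X ^ 2 - Polynomial.C 2, Polynomial.monic_X_pow_sub_C _ two_ne_zero, ?_⟩
    simp [hs]
  set s' : 𝓞 (κ.layer 1) := ⟨s, hsint⟩ with hs'
  have hs'2 : s' ^ 2 = 2 := by
    apply Subtype.ext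
    change ((s' ^ 2 : 𝓞 (κ.layer 1)) : κ.layer 1) = ((2 : 𝓞 (κ.layer 1)) : κ.layer 1)
    push_cast
    exact hs
  set f := algebraMap (𝓞 K) (𝓞 (κ.layer 1)) with hf
  have hcoe : ∀ z : 𝓞 K, algebraMap (𝓞 (κ.layer 1)) (κ.layer 1) (f z) = algebraMap K (κ.layer 1) (z : K) := fun z => by
    rw [hf]
    exact (IsScalarTower.algebraMap_apply (𝓞 K) (𝓞 (κ.layer 1)) (κ.layer 1) z).symm.trans
      (IsScalarTower.algebraMap_apply (𝓞 K) K (κ.layer 1) z)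
  have hcoes : algebraMap (𝓞 (κ.layer 1)) (κ.layer 1) s' = s := rfl
  have hcoord : ∀ x y : 𝓞 K, ((f x + f y * s' : 𝓞 (κ.layer 1)) : κ.layer 1) =
      algebraMap K (κ.layer 1) (x : K) + algebraMap K (κ.layer 1) (y : K) * s := fun x y => by
    rw [RingOfIntegers.coe_eq_algebraMap, map_add, map_mul, hcoe, hcoe, hcoes]
  -- the three units
  have hunit : ∀ {a b c d : 𝓞 K}, a * c + 2 * b * d = 1 ∧ a * d + b * c = 0 → (f a + f b * s') * (f c + f d * s') = 1 := by
    rintro a b c d ⟨h1, h2⟩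
    have h1' := congrArg f h1
    have h2' := congrArg f h2
    simp only [map_add, map_mul, map_ofNat, map_one, map_zero] at h1' h2'
    linear_combination h1' + s' * h2' + (f b * f d) * hs'2
  set u₁ : (𝓞 (κ.layer 1))ˣ := Units.mkOfMulEqOne _ _ (hunit hu₁) with hu₁def
  set u₂ : (𝓞 (κ.layer 1))ˣ := Units.mkOfMulEqOne _ _ (hunit hu₂) with hu₂def
  set u₃ : (𝓞 (κ.layer 1))ˣ := Units.mkOfMulEqOne _ _ (hunit hu₃) with hu₃def
  -- `w`, `w*`, `b = q₀`, `v` and the two ideal identities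
  set w : 𝓞 (κ.layer 1) := f A + f B * s' with hwdef
  set ws : 𝓞 (κ.layer 1) := f W₀ + f W₁ * s' with hwsdef
  set b : 𝓞 (κ.layer 1) := f q₀ with hbdef
  set v : 𝓞 (κ.layer 1) := f v₀ + f v₁ * s' with hvdef
  have hb0 : b ≠ 0 := by
    intro h
    apply hq₀
    have h' : algebraMap (𝓞 (κ.layer 1)) (κ.layer 1) b = 0 := by rw [h, map_zero]
    rw [hbdef, hcoe, map_eq_zero_iff _ (algebraMap K (κ.layer 1)).injective] at h'
    exact RingOfIntegers.coe_injective (by simpa using h')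
  have hmap : ∀ {x y : 𝓞 K}, x = y → f x = f y := fun h => by rw [h]
  have hI2 : (Ideal.span {b, v}) ^ 2 = Ideal.span {w, b ^ 2} := by
    refine span_pair_sq_eq_span_pair_of_witnesses (α := f α₀ + f α₁ * s') (β := f β₀ + f β₁ * s')
      (α' := f γ₀ + f γ₁ * s') (β' := f δ₀ + f δ₁ * s') (α'' := f m₀ + f m₁ * s') (β'' := f n₀ + f n₁ * s')
      (γ'' := f l₀ + f l₁ * s') ?_ ?_ ?_
    · have h1 := hmap hM2.1; have h2 := hmap hM2.2
      simp only [map_add, map_mul, map_ofNat, map_pow] at h1 h2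
      linear_combination h1 + s' * h2 + (-(f α₁ * f B)) * hs'2
    · have h1 := hmap hM3.1; have h2 := hmap hM3.2
      simp only [map_add, map_mul, map_ofNat, map_pow] at h1 h2
      linear_combination h1 + s' * h2 + ((f v₁) ^ 2 - f γ₁ * f B) * hs'2
    · have h1 := hmap hM4.1; have h2 := hmap hM4.2
      simp only [map_add, map_mul, map_ofNat, map_pow] at h1 h2
      linear_combination h1 + s' * h2 +
        (-(f n₁ * (f q₀ * f v₁)) - f l₀ * (f v₁) ^ 2 - f l₁ * (2 * f v₀ * f v₁) - s' * f l₁ * (f v₁) ^ 2) * hs'2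
  have hI4 : (Ideal.span {w, b ^ 2}) ^ 2 = Ideal.span {w} := by
    refine span_pair_sq_eq_span_singleton_of_witnesses (ws := ws) (μ := f μ₀ + f μ₁ * s') (ν := f ν₀ + f ν₁ * s') ?_ ?_
    · have h1 := hmap hws.1; have h2 := hmap hws.2
      simp only [map_add, map_mul, map_ofNat, map_pow, map_zero] at h1 h2
      linear_combination h1 + s' * h2 + (-(f B * f W₁)) * hs'2
    · have h1 := hmap hbez.1; have h2 := hmap hbez.2
      simp only [map_add, map_mul, map_ofNat, map_one, map_zero] at h1 h2
      linear_combination h1 + s' * h2 + (f μ₁ * f B + f ν₁ * f W₁) * hs'2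
  rw [classNumberPExp_def]
  exact two_le_padicValNat_card_classGroup_of_orderFourCert hdeg hs hsK hreal hPl u₁ u₂ u₃
    (a₁ := a₁) (b₁ := b₁) (a₂ := a₂) (b₂ := b₂) (a₃ := a₃) (b₃ := b₃) (A := A) (B := B)
    (by rw [hu₁def, Units.val_mkOfMulEqOne]; exact hcoord a₁ b₁)
    (by rw [hu₂def, Units.val_mkOfMulEqOne]; exact hcoord a₂ b₂)
    (by rw [hu₃def, Units.val_mkOfMulEqOne]; exact hcoord a₃ b₃)
    (hcoord A B) hb0 hI2 hI4 hcert

end Literature.NumberTheory.IwasawaTheory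

end
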